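import Summits.QuantumFields.YangMills.Theorems.SwapTwistDeficitEigenDataTraces
import Summits.QuantumFields.YangMills.Theorems.FemtoTransferGapStrictPositivity
import Summits.QuantumFields.YangMills.Theorems.FemtoTransferGapSlabRayleigh
import Summits.QuantumFields.YangMills.Theorems.LuscherReductionRunningReductionLatticeLargeField
import Summits.QuantumFields.YangMills.Theorems.SlowBitWindowJensenDoor
import HarnessLib

/-!
# A ground-state-free lower bound on the one-step zero-flux autocorrelation `Tr_phys(M_O (PK_β) M_O (PK_β)^{2L-1})`:
# the rank-one minorant of the transfer form and the spectral floor of `TT.insTrace L β O 1`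

Support module for the FIXED-LATTICE rung (BC5 witness «r1 at every fixed `L`») of the crux `SlowBitWindow.StepPersistence`
(item stmt-QuantumFields-23271, D-0145 LINE g10-A of seat ym-idea-4; route `SlowBitWindow` onto K2a `ThermalTraceWindow.SubFemtoFirstLevel`).
`StepPersistence` asks for a bounded swap-odd physical observable `O` whose ONE-STEP insertion trace `insTrace L β O 1` is at least
`β^{-k/L} · Z_phys(2L)`.  A lower bound on `insTrace` through the vacuum `e₀` is useless for localised witnesses (the vacuum is exponentially
small away from the toron potential minima); this module proves a lower bound that never sees the ground state:

* §1 `isPhys_expAction`, `qform_expAction_right`: the dressed constant `u = e^{+(β/2)S}` is physical and is the EXACT top direction of the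
  electric factor: `q_β(f, u) = c_β^{|E|} · ∫ f e^{−(β/2)S}` (`K_β = E_β · e^{−(β/2)(S(U)+S(V))}`, row sum `∫ E_β(U,V) dV = c_β^{|E|}`);
* §2 ★ `latCE_mul_sq_le_qform` — the RANK-ONE MINORANT: `q_β(f,f) ≥ c_β^{|E|} · (∫ f e^{−(β/2)S})²` for every physical `f` and `β ≥ 0`
  (positive semi-definiteness of the transfer form on `f − (∫ f e^{−(β/2)S}) · u`);
* §3 ★ `insTrace_one_ge`: for `L ≥ 2`, `β > 0` and a physical `O`, with `h = O · e^{−(β/2)S}`,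
  `insTrace L β O 1 ≥ c_β^{|E|} · q_β(h,h)^{2L−1} / ‖h‖^{2(2L−2)}` — along ONE eigen-data (`TT.exists_eigenData`):
  `insTrace(O,1) = Σ_{k,l} λ_k^{2L−1} λ_l (∫ O e_k e_l)² = Σ_k λ_k^{2L−1} q_β(O e_k, O e_k)` (`eigenData_insTrace`, `eigenData_bilinear`),
  `q_β(O e_k, O e_k) ≥ c_β^{|E|} (∫ h e_k)²` (§2), `Σ_k λ_k^{2L−1} (∫ h e_k)² ≥ q_β(h,h)^{2L−1}/‖h‖^{2(2L−2)}` (Bessel + tangent-line Jensen with weights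
  `(∫ h e_k)²` and first moment `Σ_k λ_k (∫ h e_k)² = q_β(h,h)`).

HONEST FRAMING: fixed-lattice transfer-matrix bookkeeping for a finite-dimensional variational witness of a DRAFT line onto a RECORD rung (K2a ⟶ R2ξ″);
no semiclassics, no renormalisation group; nothing here bears on infinite volume, the continuum limit or the Clay Yang–Mills gap.  No `sorry`, no new
axiom, no new definition.  References: [cite: ReedSimonIV1978, Thm. XIII.1]; [cite: ReedSimonI1980, Thm. VI.22–VI.23]; [cite: MadrasSokal1988, §2]
(autocorrelations and the second eigenvalue); [cite: SeilerLNP1982, §3]; [cite: MontvayMunster1994, (3.145)].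
-/

set_option autoImplicit false

noncomputable section

open MeasureTheory Filter Topology Real Function
open Literature.MathematicalPhysics.QuantumLattice
open Literature.MathematicalPhysics.QuantumFieldTheory hiding SU2
open scoped BigOperators

namespace Summit.QuantumFields.YangMills.Theorems.FemtoTransferGap

variable {L : ℕ} [NeZero L]

/-! ## §1 The dressed constant `e^{c S}` and the exact top direction of the electric factor -/

/-- `U ↦ e^{c · S(U)}` is a physical zero-flux test function (continuous on a compact space, gauge and centre-twist invariant). [folklore] -/
theorem isPhys_expAction (c : ℝ) : IsPhys (fun U : GaugeConfig 3 L SU2 => Real.exp (c * wilsonAction su2Rep U)) := by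
  haveI : SecondCountableTopology SU2 := secondCountableTopology_su2
  have hcont : Continuous fun U : GaugeConfig 3 L SU2 => Real.exp (c * wilsonAction su2Rep U) :=
    Real.continuous_exp.comp (continuous_const.mul (continuous_wilsonAction su2Rep continuous_su2Rep))
  obtain ⟨W, hW⟩ := (isCompact_range hcont).bddAbove
  refine ⟨hcont.measurable, ⟨W, fun U => ?_⟩, fun g U => ?_, fun k z hz U => ?_⟩
  · rw [abs_of_pos (Real.exp_pos _)]; exact hW (Set.mem_range_self U)
  · simp only [wilsonAction_gaugeTransform]
  · simp only [wilsonAction_twist_of_mem_center su2Rep k hz]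

/-- `0 < e^{−(β/2)S} ≤ 1` for `β ≥ 0` (the Wilson action is non-negative). [folklore] -/
theorem expAction_le_one {β : ℝ} (hβ : 0 ≤ β) (U : GaugeConfig 3 L SU2) : Real.exp (-(β / 2) * wilsonAction su2Rep U) ≤ 1 :=
  Real.exp_le_one_iff.2 (by nlinarith [wilsonAction_su2_nonneg_lat U])

/-- **The dressed constant is the exact top direction of the electric factor**: for a physical `f` and `β ≥ 0`,
`q_β(f, e^{(β/2)S}) = c_β^{|E|} · ∫ f e^{−(β/2)S}` (`K_β(U,V) e^{(β/2)S(V)} = E_β(U,V) e^{−(β/2)S(U)}` and `∫ E_β(U,V) dV = c_β^{|E|}`). [cite: SeilerLNP1982, §3] -/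
theorem qform_expAction_right {β : ℝ} (hβ : 0 ≤ β) {f : GaugeConfig 3 L SU2 → ℝ} (hf : IsPhys f) :
    qform su2Rep β f (fun U => Real.exp (β / 2 * wilsonAction su2Rep U)) =
      latCE L β * ∫ U, f U * Real.exp (-(β / 2) * wilsonAction su2Rep U) ∂configMeasure SU2 L := by
  haveI : SecondCountableTopology SU2 := secondCountableTopology_su2
  obtain ⟨C, hC⟩ := hf.bounded
  have hu : IsPhys (fun U : GaugeConfig 3 L SU2 => Real.exp (β / 2 * wilsonAction su2Rep U)) := isPhys_expAction (β / 2)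
  rw [qform_eq_integral_prod su2Rep continuous_su2Rep β hf hu]
  have hpt : ∀ p : GaugeConfig 3 L SU2 × GaugeConfig 3 L SU2,
      f p.1 * transferKernel su2Rep β p.1 p.2 * Real.exp (β / 2 * wilsonAction su2Rep p.2) =
        latE L β p.1 p.2 * (f p.1 * Real.exp (-(β / 2) * wilsonAction su2Rep p.1)) := by
    intro p
    have hexp : Real.exp (-(β / 2) * (wilsonAction su2Rep p.1 + wilsonAction su2Rep p.2)) * Real.exp (β / 2 * wilsonAction su2Rep p.2) =
        Real.exp (-(β / 2) * wilsonAction su2Rep p.1) := by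
      rw [← Real.exp_add]; congr 1; ring
    rw [transferKernel_eq_latE_mul, ← hexp]
    ring
  simp_rw [hpt]
  have hΦm : Measurable fun U : GaugeConfig 3 L SU2 => f U * Real.exp (-(β / 2) * wilsonAction su2Rep U) :=
    (isPhys_mul_expAction β hf).measurable
  have hΦb : ∀ U : GaugeConfig 3 L SU2, |f U * Real.exp (-(β / 2) * wilsonAction su2Rep U)| ≤ C := fun U => by
    rw [abs_mul, abs_of_pos (Real.exp_pos _)]
    exact (mul_le_of_le_one_right (abs_nonneg _) (expAction_le_one hβ U)).trans (hC U)
  exact integral_prod_latE_mul_fst β hΦm hΦb hβ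

/-- `q_β(e^{(β/2)S}, e^{(β/2)S}) = c_β^{|E|}`. [folklore] -/
theorem qform_expAction_self {β : ℝ} (hβ : 0 ≤ β) :
    qform su2Rep β (fun U : GaugeConfig 3 L SU2 => Real.exp (β / 2 * wilsonAction su2Rep U))
      (fun U => Real.exp (β / 2 * wilsonAction su2Rep U)) = latCE L β := by
  rw [qform_expAction_right hβ (isPhys_expAction (β / 2))]
  have h1 : ∀ U : GaugeConfig 3 L SU2, Real.exp (β / 2 * wilsonAction su2Rep U) * Real.exp (-(β / 2) * wilsonAction su2Rep U) = 1 := fun U => by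
    rw [← Real.exp_add, show β / 2 * wilsonAction su2Rep U + -(β / 2) * wilsonAction su2Rep U = 0 by ring, Real.exp_zero]
  simp_rw [h1]
  rw [integral_const, smul_eq_mul, probReal_univ, one_mul, mul_one]

/-! ## §2 The rank-one minorant of the transfer form -/

/-- ★ **Rank-one minorant of the transfer form.**  For every physical `f` and `β ≥ 0`:
`c_β^{|E|} · (∫ f e^{−(β/2)S})² ≤ q_β(f, f)`.  With `u = e^{(β/2)S}` and `c = ∫ f e^{−(β/2)S}`, the transfer form is non-negative on `f − c·u`
(`qform_su2Rep_self_nonneg`) and `q_β(f,u) = c·c_β^{|E|}`, `q_β(u,u) = c_β^{|E|}` (§1), so `0 ≤ q_β(f,f) − c² c_β^{|E|}`: the transfer operator dominates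
`c_β^{|E|}` times the projection onto its dressed constant direction. [cite: ReedSimonIV1978, Thm. XIII.1] [cite: SeilerLNP1982, §3] -/
theorem latCE_mul_sq_le_qform {β : ℝ} (hβ : 0 ≤ β) {f : GaugeConfig 3 L SU2 → ℝ} (hf : IsPhys f) :
    latCE L β * (∫ U, f U * Real.exp (-(β / 2) * wilsonAction su2Rep U) ∂configMeasure SU2 L) ^ 2 ≤ qform su2Rep β f f := by
  set c : ℝ := ∫ U, f U * Real.exp (-(β / 2) * wilsonAction su2Rep U) ∂configMeasure SU2 L with hc
  set u : GaugeConfig 3 L SU2 → ℝ := fun U => Real.exp (β / 2 * wilsonAction su2Rep U) with hu_def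
  have hu : IsPhys u := isPhys_expAction (β / 2)
  have hfu : qform su2Rep β f u = latCE L β * c := qform_expAction_right hβ hf
  have huf : qform su2Rep β u f = latCE L β * c := by rw [qform_su2Rep_comm β hu hf, hfu]
  have huu : qform su2Rep β u u = latCE L β := qform_expAction_self hβ
  set ψ : GaugeConfig 3 L SU2 → ℝ := f + (-c) • u with hψ_def
  have hψ : IsPhys ψ := hf.add (hu.smul (-c))
  have h0 : 0 ≤ qform su2Rep β ψ ψ := qform_su2Rep_self_nonneg hβ hψ
  have hexp : qform su2Rep β ψ ψ = qform su2Rep β f f - latCE L β * c ^ 2 := by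
    rw [hψ_def, qform_add_left β hf (hu.smul (-c)) hψ, qform_smul_left, qform_su2Rep_comm β hf hψ, qform_su2Rep_comm β hu hψ,
      qform_add_left β hf (hu.smul (-c)) hf, qform_add_left β hf (hu.smul (-c)) hu, qform_smul_left, qform_smul_left, huf, hfu, huu]
    ring
  rw [hexp] at h0
  linarith

end Summit.QuantumFields.YangMills.Theorems.FemtoTransferGap

/-! ## §3 The spectral floor of the one-step insertion trace -/

namespace Summit.QuantumFields.YangMills.Theorems.FemtoTransferGap.TT

open Summit.QuantumFields.YangMills.Theorems.FemtoTransferGap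

variable {L : ℕ} [NeZero L]

set_option maxHeartbeats 800000 in
/-- ★ **Spectral floor of the one-step insertion trace (no ground state needed).**  For `L ≥ 2`, `β > 0`, a physical observable `O` with
`|O| ≤ C_O` and its dressed version `h = O · e^{−(β/2)S}` (if `‖h‖² = 0` both sides vanish / the bound is trivial; real division by zero is zero):
`c_β^{|E|} · q_β(h,h)^{2L−1} / ‖h‖^{2(2L−2)} ≤ insTrace L β O 1`.
Along one eigen-data: `insTrace(O,1) = Σ_k λ_k^{2L−1} q_β(O e_k, O e_k) ≥ c_β^{|E|} Σ_k λ_k^{2L−1} (∫ h e_k)²` (rank-one minorant, `∫ (O e_k) e^{−(β/2)S} = ∫ h e_k`),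
and `Σ_k λ_k^{2L−1} (∫ h e_k)² ≥ q_β(h,h)^{2L−1} / ‖h‖^{2(2L−2)}` (weights `(∫ h e_k)²` of total `≤ ‖h‖²` by Bessel, first moment `Σ_k λ_k(∫ h e_k)² = q_β(h,h)`,
tangent-line Jensen). [cite: ReedSimonI1980, Thm. VI.22–VI.23] [cite: MadrasSokal1988, §2] [cite: MontvayMunster1994, (3.145)] -/
theorem insTrace_one_ge (hL : 2 ≤ L) {β : ℝ} (hβ : 0 < β) {O : GaugeConfig 3 L SU2 → ℝ} (hO : IsPhys O) {CO : ℝ} (hOb : ∀ U, |O U| ≤ CO) :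
    latCE L β * qform su2Rep β (fun U => O U * Real.exp (-(β / 2) * wilsonAction su2Rep U)) (fun U => O U * Real.exp (-(β / 2) * wilsonAction su2Rep U))
        ^ (2 * L - 1) /
      l2 (fun U => O U * Real.exp (-(β / 2) * wilsonAction su2Rep U)) (fun U => O U * Real.exp (-(β / 2) * wilsonAction su2Rep U)) ^ (2 * L - 2) ≤
      insTrace L β O 1 := by
  classical
  set T : ℕ := 2 * L - 1 with hTdef
  have hT3 : 3 ≤ T := by omega
  have hT1 : 1 ≤ T := by omega
  obtain ⟨ι, _, b, lam, AP, emb, e, hAP, hsa, hbAP, -, hinj, hoff, hlam, hbe, he, -, -, -⟩ := exists_eigenData (L := L) hβ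
  obtain ⟨M0, -, hM0⟩ := exists_abs_transferKernel_le (L := L) β
  have hCO : 0 ≤ CO := (abs_nonneg _).trans (hOb (fun _ => 1))
  set w : GaugeConfig 3 L SU2 → ℝ := fun U => Real.exp (-(β / 2) * wilsonAction su2Rep U) with hw
  set h : GaugeConfig 3 L SU2 → ℝ := fun U => O U * Real.exp (-(β / 2) * wilsonAction su2Rep U) with hh_def
  have hh : IsPhys h := isPhys_mul_expAction β hO
  have hhm := hh.measurable
  obtain ⟨Ch, hCh⟩ := hh.bounded
  have hhb : ∀ x, ‖h x‖ ≤ Ch := fun x => by rw [Real.norm_eq_abs]; exact hCh x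
  have hlam0 : ∀ k, 0 ≤ levelValue su2Rep L β k := fun k => (levelValue_su2Rep_pos hβ k).le
  set n2 : ℝ := l2 h h with hn2
  set q : ℝ := qform su2Rep β h h with hq
  -- the honest observables `O e_k`
  have hgk : ∀ k, IsPhys (fun U => O U * e k U) := fun k => (he k).mul_of_invariant hO.measurable hOb hO.gaugeInv hO.zeroFlux
  -- (A) `insTrace(O,1)` as a double sum
  set F : ℕ × ℕ → ℝ := fun p => levelValue su2Rep L β p.1 ^ (2 * L - 1) * levelValue su2Rep L β p.2 ^ 1 *
    (∫ U, O U * e p.1 U * e p.2 U ∂configMeasure SU2 L) ^ 2 with hF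
  have hins : HasSum F (insTrace L β O 1) := eigenData_insTrace hβ hAP hsa hbAP hinj hoff hlam hbe he hO hOb (m := 1) le_rfl (by omega)
  -- (B) fibres: `Σ_l F(k,l) = λ_k^{2L-1} q_β(O e_k, O e_k)`
  have hfib : ∀ k, HasSum (fun l => F (k, l)) (levelValue su2Rep L β k ^ (2 * L - 1) * qform su2Rep β (fun U => O U * e k U) (fun U => O U * e k U)) := by
    intro k
    obtain ⟨Bk, hBk⟩ := (hgk k).bounded
    have hBk' : ∀ x, ‖O x * e k x‖ ≤ Bk := fun x => by rw [Real.norm_eq_abs]; exact hBk x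
    have h1 := eigenData_bilinear hAP hsa hbAP hinj hoff hlam hbe (hgk k).measurable hBk' (hgk k).measurable hBk' (n := 1) le_rfl
    have hval : ∫ U, (fun U => O U * e k U) U * ((fun φ : GaugeConfig 3 L SU2 → ℝ => fun x =>
        ∫ z, physKernel β x z * φ z ∂configMeasure SU2 L)^[1] (fun U => O U * e k U)) U ∂configMeasure SU2 L =
        qform su2Rep β (fun U => O U * e k U) (fun U => O U * e k U) := by
      rw [Function.iterate_one, qform_eq_l2_transferApply]
      unfold l2
      refine integral_congr_ae (ae_of_all _ fun U => ?_)
      show _ * _ = _ * _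
      rw [integral_physKernel_mul_of_isPhys hM0 (hgk k) U, transferApply_apply]
    rw [hval] at h1
    refine (h1.mul_left (levelValue su2Rep L β k ^ (2 * L - 1))).congr_fun fun l => ?_
    simp only [hF, pow_one, sq]
    ring
  have houter : HasSum (fun k => levelValue su2Rep L β k ^ (2 * L - 1) * qform su2Rep β (fun U => O U * e k U) (fun U => O U * e k U))
      (insTrace L β O 1) := hins.prod_fiberwise hfib
  -- (C) the rank-one minorant on each fibre value
  set c : ℕ → ℝ := fun k => (∫ U, h U * e k U ∂configMeasure SU2 L) ^ 2 with hc
  have hc0 : ∀ k, 0 ≤ c k := fun k => sq_nonneg _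
  have hmin : ∀ k, latCE L β * c k ≤ qform su2Rep β (fun U => O U * e k U) (fun U => O U * e k U) := by
    intro k
    have hm := latCE_mul_sq_le_qform hβ.le (hgk k)
    have hint : ∫ U, O U * e k U * Real.exp (-(β / 2) * wilsonAction su2Rep U) ∂configMeasure SU2 L = ∫ U, h U * e k U ∂configMeasure SU2 L :=
      integral_congr_ae (ae_of_all _ fun U => by simp only [hh_def]; ring)
    rw [hint] at hm
    exact hm
  -- (D) `Σ_k λ_k^T c_k = V`
  have hVs := eigenData_bilinear hAP hsa hbAP hinj hoff hlam hbe hhm hhb hhm hhb (n := T) hT1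
  set V : ℝ := ∫ U, h U * ((fun φ : GaugeConfig 3 L SU2 → ℝ => fun x =>
      ∫ z, physKernel β x z * φ z ∂configMeasure SU2 L)^[T] h) U ∂configMeasure SU2 L with hVdef
  have hV_sum : HasSum (fun k => levelValue su2Rep L β k ^ T * c k) V :=
    hVs.congr_fun fun k => by simp only [hc, sq]; ring
  have hstep1 : latCE L β * V ≤ insTrace L β O 1 := by
    refine hasSum_le (fun k => ?_) (hV_sum.mul_left (latCE L β)) houter
    calc latCE L β * (levelValue su2Rep L β k ^ T * c k) = levelValue su2Rep L β k ^ (2 * L - 1) * (latCE L β * c k) := by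
          rw [hTdef]; ring
      _ ≤ levelValue su2Rep L β k ^ (2 * L - 1) * qform su2Rep β (fun U => O U * e k U) (fun U => O U * e k U) :=
          mul_le_mul_of_nonneg_left (hmin k) (pow_nonneg (hlam0 k) _)
  -- (E) Bessel and the first moment
  obtain ⟨hc_sum, hc_le⟩ := eigenData_bessel hinj hbe hhm hhb
  have hc_le' : ∑' k, c k ≤ n2 := by
    refine hc_le.trans (le_of_eq ?_)
    rw [hn2]; unfold l2
    exact integral_congr_ae (ae_of_all _ fun U => by ring)
  have h1 := eigenData_bilinear hAP hsa hbAP hinj hoff hlam hbe hhm hhb hhm hhb (n := 1) le_rfl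
  have hval1 : ∫ U, h U * ((fun φ : GaugeConfig 3 L SU2 → ℝ => fun x =>
      ∫ z, physKernel β x z * φ z ∂configMeasure SU2 L)^[1] h) U ∂configMeasure SU2 L = q := by
    rw [Function.iterate_one, hq, qform_eq_l2_transferApply]
    unfold l2
    refine integral_congr_ae (ae_of_all _ fun U => ?_)
    show h U * _ = h U * _
    rw [integral_physKernel_mul_of_isPhys hM0 hh U, transferApply_apply]
  rw [hval1] at h1
  have hq_sum : HasSum (fun k => levelValue su2Rep L β k * c k) q :=
    h1.congr_fun fun k => by simp only [hc, pow_one]; ring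
  have hq0 : 0 ≤ q := by rw [hq]; exact qform_su2Rep_self_nonneg hβ.le hh
  -- (F) tangent-line Jensen: `V ≥ q^T / n2^{T-1}`
  have hstep2 : q ^ T / n2 ^ (T - 1) ≤ V := by
    set m : ℝ := ∑' k, c k with hm
    have hm_sum : HasSum c m := hc_sum.hasSum
    have hm0 : 0 ≤ m := hm_sum.nonneg hc0
    rcases hm0.eq_or_lt with hm00 | hmpos
    · have hck : ∀ k, c k = 0 := fun k =>
        le_antisymm ((le_hasSum hm_sum k fun j _ => hc0 j).trans (le_of_eq hm00.symm)) (hc0 k)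
      have h0 : HasSum (fun k => levelValue su2Rep L β k * c k) 0 := by
        have : (fun k => levelValue su2Rep L β k * c k) = fun _ => 0 := funext fun k => by rw [hck k, mul_zero]
        rw [this]; exact hasSum_zero
      have hq00 : q = 0 := hq_sum.unique h0
      have hV0 : 0 ≤ V := hV_sum.nonneg fun k => mul_nonneg (pow_nonneg (hlam0 k) _) (hc0 k)
      rw [hq00, zero_pow (by omega), zero_div]; exact hV0
    · set r : ℝ := q / m with hr
      have hr0 : 0 ≤ r := div_nonneg hq0 hmpos.le
      have hlin : HasSum (fun k => (r ^ T + T * r ^ (T - 1) * (levelValue su2Rep L β k - r)) * c k) (r ^ T * m) := by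
        have h := ((hm_sum.mul_left (r ^ T - T * r ^ (T - 1) * r)).add (hq_sum.mul_left (T * r ^ (T - 1))))
        have hval : (r ^ T - T * r ^ (T - 1) * r) * m + T * r ^ (T - 1) * q = r ^ T * m := by
          have : q = r * m := by rw [hr]; field_simp
          rw [this]; ring
        rw [hval] at h
        exact h.congr_fun fun k => by ring
      have htan : r ^ T * m ≤ V :=
        hasSum_le (fun k => mul_le_mul_of_nonneg_right (SlowBitWindow.pow_tangent_le T (hlam0 k) hr0) (hc0 k)) hlin hV_sum
      have hmn : m ≤ n2 := hc_le'
      have hrm : q ^ T / n2 ^ (T - 1) ≤ r ^ T * m := by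
        have hm0' : m ≠ 0 := hmpos.ne'
        have hmT : m ^ T = m ^ (T - 1) * m := by rw [← pow_succ]; congr 1; omega
        have e1 : r ^ T * m = q ^ T / m ^ (T - 1) := by
          rw [hr, div_pow, hmT]
          field_simp
        rw [e1]
        exact div_le_div_of_nonneg_left (pow_nonneg hq0 _) (pow_pos hmpos _) (pow_le_pow_left₀ hmpos.le hmn _)
      exact hrm.trans htan
  -- assemble
  have hTm1 : T - 1 = 2 * L - 2 := by omega
  rw [← hTm1]
  calc latCE L β * q ^ T / n2 ^ (T - 1) = latCE L β * (q ^ T / n2 ^ (T - 1)) := by ring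
    _ ≤ latCE L β * V := mul_le_mul_of_nonneg_left hstep2 (latCE_pos hβ.le).le
    _ ≤ insTrace L β O 1 := hstep1

end Summit.QuantumFields.YangMills.Theorems.FemtoTransferGap.TT

end
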